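import Summits.QuantumFields.YangMills.Theorems.BalabanUVNodesN18KingModelU3Rung

/-!
# BalabanUVNodes ∕ N18 — MANY LINES PER LIVE DOMAIN: a polynomial loss in the TREE LENGTH (the number of lines a polymer
# carries) is eaten by half the decay exponent; `NE5` at the END's carriers `torusCarriers N W` ∕ `reFunctional N W` for
# read-outs that are finite sums of located line contributions; and the count: a localization domain `X ∈ 𝐃_j` carries at
# most `|X|² ≤ (4·2^d)²·(d_j(X) + 1)²` pairs of its own cubes (Track A, DAG node N18 = NE5 `T4OutputRate.NE5 EA EB W κ θ C₅`
# :211; row n18 s3 «King-model transfer → `TwoRunTorusNE5Final*`», module 2 of seat g2; the tree-length twin of the LENS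
# card T2 «loss absorption» of `ym-lens-BalabanUVNodes-transfer/LENS-transfer.md`)

HONEST FRAMING.  Count-neutral kernel bookkeeping (seat pub-ymgap-dag-n18-e g2; `--supports stmt-QuantumFields-19676` = K3
`SpineGivenEndpointR11`).  Generic real analysis and torus combinatorics around the cell's `NE5` shape; NOT Bałaban's
one-step outputs `E^{(j)}(X; g, U_k(V))` ([Balaban1987RG1] (0.24)∕(2.13)), for which NE5 is NOT IN PRINT and has no tree
producer (NODE O instance 0∕1); NOT a node discharge; nothing continuum ∕ ℝ⁴ ∕ OS ∕ mass-gap ∕ Clay.  THEOREMS ONLY: 0 `def`,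
0 `sorry`, standard axioms.

THE POINT.  Module 1 of this seat (`BalabanUVNodesN18KingModelEndDecay`, p458808) reads ONE line (one pair of points) per live
domain and says so under «WHAT THIS DOES NOT DO»: Bałaban's activity `E^{(j)}(X)` collects ALL the lines localized in `X`
([Balaban1985UV3] p. 262 *"The localizations {□_j} and the walks ω replacing lines of the graph define a localization X …
This localization is simply a union of all these sets"*), with a combinatorial factor.  At the level of unit cubes that
factor is harmless: a domain `X` carries at most `|X|²` pairs of its cubes, `|X| ≤ 2^d(4d_j(X) + 1)` ((2.30) lower half,
repaired, `TreeLengthTorus.card_le_torusTreeLen`), and `(d_j + 1)^m·e^{−κ d_j} ≤ m!(2∕κ)^m e^{κ∕2}·e^{−(κ∕2) d_j}`.  Hence: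
* §1 `polyTreeLoss_le` — `(t + 1)^m·e^{−κt} ≤ (m!·(2∕κ)^m·e^{κ∕2})·e^{−(κ∕2)t}` for `t ≥ 0`, `κ > 0`
  (`Real.pow_div_factorial_le_exp` at `x = (κ∕2)(t + 1)`).
* §2 **`ne5_of_polyTreeLoss`** (ANY carriers): a two-run comparison with a polynomial tree-length loss,
  `|E_A g (transport U) X − E_B g U X| ≤ A·(d X + 1)^m·θ^{scale X}·e^{−κ·d X}`, IS `NE5 E_A E_B W (κ∕2) θ (A·m!(2∕κ)^m e^{κ∕2})` —
  the `NE5` statement of record is untouched; the lossy shape is an INPUT (as in the lens's `NE5Lossy`, whose loss is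
  polynomial in the SCALE and is eaten by the rate slack `θ < θ′`; here the loss is polynomial in `d_j(X)` and is eaten by
  the decay slack `κ∕2 < κ`).
* §3 **`ne5_reFunctional_of_locatedSum`** (the END's carriers): real families `K_A, K_B` on `Σ_j 𝐃_j` whose difference at
  each domain is a finite sum of LINE contributions, `K_A X − K_B X = Σ_{i ∈ P X} (G_A X i − G_B X i)`, every line located
  (`|G_A X i − G_B X i| ≤ C₅·θ^j·e^{−κ·d_j(X)}` — e.g. King's (4.42) three-factor graph of a pair of blocks whose connecting
  polymer is `X`, module 1 §2 with `κ = κ_King·ρ`) and polynomially many lines (`|P X| ≤ A·(d_j(X) + 1)^m`), satisfy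
  `NE5 (torusCarriers N W) (reFunctional N W K_A) (reFunctional N W K_B) W′ (κ∕2) θ (C₅·A·m!(2∕κ)^m e^{κ∕2})`
  (`N18KingModelU3Rung.ne5_reFunctional_of_real`, p450669).
* §4 `card_pairs_le_of_tFaceConnected` ∕ `card_pairs_le_of_tdom` — the count binder of §3 with `m = 2`, `A = (4·2^d)²` for
  «all pairs of cubes of `X`»: `|X ×ˢ X| ≤ (4·2^d)²·(d_j(X) + 1)²`.
* §5 **`ne5_reFunctional_of_cubePairs`** — §3 + §4: read-outs differing by located line contributions over ALL pairs of
  cubes of each domain are `NE5 (torusCarriers N W) … (κ∕2) θ (C₅·4096·2!(2∕κ)² e^{κ∕2})`.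
WHAT THIS DOES NOT DO.  The lines are indexed by pairs of UNIT CUBES (blocks); the fine-point multiplicity inside a block
and King's (2.20)-rescaling `(L^jη)^{2−d−γ}` that normalises it are outside (as in the whole n18-a∕-e lineage); no vertex
functions; `A = 0` when instantiated with King's graphs.

Sources: T. Bałaban, Commun. Math. Phys. **109** (1987) 249–301 [Balaban1987RG1] — p. 257 (localization domains, linear
size `d_j(X)`), (0.24)–(0.25) p. 257, Thm 1 p. 259; **116** (1988) 1–22 [Balaban1988RG2Cluster] (2.30) p. 18; **102** (1985)
255–275 [Balaban1985UV3] p. 262, (23)–(25); C. King, Commun. Math. Phys. **102** (1986) 649–677 [King1986] Prop. 3.9 (3.73)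
p. 665, (4.42)–(4.43) p. 675 (the located lines), Thm 3.5 (3.39)∕(3.53) (losses per vertex, the lens's T2).  No claim about
the Yang–Mills mass gap.
-/

noncomputable section

namespace Summit.QuantumFields.YangMills.BalabanUVNodes.N18EndCarriersLineSums

open Literature.MathematicalPhysics.QuantumFieldTheory.Balaban1983to89
open Literature.MathematicalPhysics.QuantumFieldTheory.Balaban1983to89.T4OutputRate (Carriers Functional NE5)
open Literature.MathematicalPhysics.QuantumFieldTheory.Balaban1983to89.TreeLengthTorus
  (TPt TFaceConnected TDom torusTreeLen torusTreeLen_nonneg card_le_torusTreeLen tsys)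
open Literature.MathematicalPhysics.QuantumFieldTheory.Balaban1983to89.B13Lemma3Torus (TwoTorusStep)
open Summit.QuantumFields.BalabanUV.T4Continuum.Spine.NE5.TwoRunTorusNE5 (torusCarriers reFunctional)
open Summit.QuantumFields.YangMills.BalabanUVNodes.N18KingModelU3Rung (ne5_reFunctional_of_real)

/-! ## §1 A polynomial loss in the tree length is eaten by half the decay exponent -/

/-- **Polynomial × exponential absorption.**  For `κ > 0`, `m ∈ ℕ` and `t ≥ 0`:
`(t + 1)^m · e^{−κt} ≤ (m! · (2∕κ)^m · e^{κ∕2}) · e^{−(κ∕2)t}` — from `x^m∕m! ≤ e^x` (`Real.pow_div_factorial_le_exp`) at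
`x = (κ∕2)(t + 1)`. [folklore] -/
theorem polyTreeLoss_le {κ : ℝ} (hκ : 0 < κ) (m : ℕ) {t : ℝ} (ht : 0 ≤ t) :
    (t + 1) ^ m * Real.exp (-(κ * t))
      ≤ ((m.factorial : ℝ) * (2 / κ) ^ m * Real.exp (κ / 2)) * Real.exp (-(κ / 2 * t)) := by
  have hm : (0 : ℝ) < m.factorial := by exact_mod_cast m.factorial_pos
  have hx : 0 ≤ κ / 2 * (t + 1) := by positivity
  -- `((κ/2)(t+1))^m / m! ≤ e^{(κ/2)(t+1)}`
  have h1 := Real.pow_div_factorial_le_exp _ hx m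
  rw [div_le_iff₀ hm, mul_pow] at h1
  -- `(t+1)^m ≤ (2/κ)^m · m! · e^{(κ/2)(t+1)}`
  have h2 : (t + 1) ^ m ≤ (2 / κ) ^ m * ((m.factorial : ℝ) * Real.exp (κ / 2 * (t + 1))) := by
    have hk : (0 : ℝ) < (κ / 2) ^ m := by positivity
    have hinv : (2 / κ) ^ m * (κ / 2) ^ m = 1 := by
      rw [← mul_pow, show 2 / κ * (κ / 2) = 1 by field_simp, one_pow]
    calc (t + 1) ^ m = (2 / κ) ^ m * ((κ / 2) ^ m * (t + 1) ^ m) := by rw [← mul_assoc, hinv, one_mul]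
      _ ≤ (2 / κ) ^ m * (Real.exp (κ / 2 * (t + 1)) * m.factorial) :=
          mul_le_mul_of_nonneg_left h1 (by positivity)
      _ = (2 / κ) ^ m * ((m.factorial : ℝ) * Real.exp (κ / 2 * (t + 1))) := by ring
  have h3 : Real.exp (κ / 2 * (t + 1)) * Real.exp (-(κ * t)) = Real.exp (κ / 2) * Real.exp (-(κ / 2 * t)) := by
    rw [← Real.exp_add, ← Real.exp_add]; ring_nf
  calc (t + 1) ^ m * Real.exp (-(κ * t))
      ≤ (2 / κ) ^ m * ((m.factorial : ℝ) * Real.exp (κ / 2 * (t + 1))) * Real.exp (-(κ * t)) :=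
        mul_le_mul_of_nonneg_right h2 (Real.exp_pos _).le
    _ = (m.factorial : ℝ) * (2 / κ) ^ m * (Real.exp (κ / 2 * (t + 1)) * Real.exp (-(κ * t))) := by ring
    _ = ((m.factorial : ℝ) * (2 / κ) ^ m * Real.exp (κ / 2)) * Real.exp (-(κ / 2 * t)) := by rw [h3]; ring

/-- The absorption constant `m!·(2∕κ)^m·e^{κ∕2}` is positive. [folklore] -/
theorem polyTreeLoss_const_pos {κ : ℝ} (hκ : 0 < κ) (m : ℕ) :
    0 < (m.factorial : ℝ) * (2 / κ) ^ m * Real.exp (κ / 2) := by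
  have hm : (0 : ℝ) < m.factorial := by exact_mod_cast m.factorial_pos
  positivity

/-! ## §2 `NE5` from a two-run comparison with a polynomial tree-length loss (any carriers) -/

/-- **`NE5` FROM A POLYNOMIAL TREE-LENGTH LOSS** (any carriers `C`).  If at every admissible coupling sequence, run-B
background and domain `|E_A g (transport U) X − E_B g U X| ≤ A·(d X + 1)^m·θ^{scale X}·e^{−κ·d X}` with `κ > 0`, `θ ≥ 0`,
`A ≥ 0`, then `NE5 E_A E_B W (κ∕2) θ (A·m!·(2∕κ)^m·e^{κ∕2})` — the node's statement of record ([Balaban1987RG1] (0.25)'s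
`e^{−κ d_j(X)}`, Thm 1's uniformity) at half the exponent; the lossy shape is an INPUT, `NE5` is untouched (`polyTreeLoss_le`).
[cite: Balaban1987RG1, (0.24)-(0.25) p.257, Thm 1 p.259] -/
theorem ne5_of_polyTreeLoss {C : Carriers} {EA : Functional C C.BgA} {EB : Functional C C.BgB} {W : Set (ℕ → ℝ)}
    {κ θ A : ℝ} {m : ℕ} (hκ : 0 < κ) (hθ : 0 ≤ θ) (hA : 0 ≤ A)
    (h : ∀ g ∈ W, ∀ (U : C.BgB) (X : C.Dom),
      |EA g (C.transport U) X - EB g U X| ≤ A * (C.d X + 1) ^ m * θ ^ C.scale X * Real.exp (-(κ * C.d X))) :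
    NE5 EA EB W (κ / 2) θ (A * ((m.factorial : ℝ) * (2 / κ) ^ m * Real.exp (κ / 2))) := by
  intro g hg U X
  have hB := polyTreeLoss_le hκ m (C.d_nonneg X)
  have hθX : 0 ≤ θ ^ C.scale X := pow_nonneg hθ _
  calc |EA g (C.transport U) X - EB g U X|
      ≤ A * (C.d X + 1) ^ m * θ ^ C.scale X * Real.exp (-(κ * C.d X)) := h g hg U X
    _ = A * θ ^ C.scale X * ((C.d X + 1) ^ m * Real.exp (-(κ * C.d X))) := by ring
    _ ≤ A * θ ^ C.scale X * (((m.factorial : ℝ) * (2 / κ) ^ m * Real.exp (κ / 2)) * Real.exp (-(κ / 2 * C.d X))) :=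
        mul_le_mul_of_nonneg_left hB (mul_nonneg hA hθX)
    _ = A * ((m.factorial : ℝ) * (2 / κ) ^ m * Real.exp (κ / 2)) * θ ^ C.scale X
          * Real.exp (-(κ / 2 * C.d X)) := by ring

/-! ## §3 The END's carriers: read-outs that are finite sums of located line contributions -/

section EndCarriers

variable {L' : ℕ} [NeZero L']

/-- **LOCATED LINE SUMS ARE `NE5` AT THE END'S CARRIERS.**  Let `K_A, K_B` be real families on the END's domains `Σ_j 𝐃_j`
whose difference at each domain is a finite sum of line contributions, `K_A X − K_B X = Σ_{i ∈ P X} (G_A X i − G_B X i)`,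
with every line LOCATED at its domain — `|G_A X i − G_B X i| ≤ C₅·θ^{j}·e^{−κ·d_j(X)}` (`C₅, θ ≥ 0`, `κ > 0`; e.g. King's
(4.42) three-factor graph of a pair of blocks whose connecting polymer is `X`, `BalabanUVNodesN18KingModelEndDecay` §2) — and
polynomially many lines, `|P X| ≤ A·(d_j(X) + 1)^m`.  Then for every torus family `W` and window `W′` the read-outs
`E_A j X φ = K_A⟨j, X⟩`, `E_B j X φ = K_B⟨j, X⟩` satisfy
`NE5 (torusCarriers N W) (reFunctional N W E_A) (reFunctional N W E_B) W′ (κ∕2) θ (C₅·A·m!(2∕κ)^m e^{κ∕2})` — the carriers and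
read-out on which `TwoRunTorusNE5Final8.ne5_end_final_all8` concludes (`ne5_reFunctional_of_real`, `polyTreeLoss_le`).
[cite: Balaban1987RG1, (0.24)-(0.25) p.257, Thm 1 p.259; Balaban1985UV3, p.262] -/
theorem ne5_reFunctional_of_locatedSum (N : ℕ → ℕ) [∀ j, NeZero (N j)]
    (W : (j : ℕ) → TwoTorusStep 4 L' (N j)) (KA KB : (Σ j : ℕ, TDom 4 (N j)) → ℝ)
    {ι : (Σ j : ℕ, TDom 4 (N j)) → Type*} (P : (X : Σ j : ℕ, TDom 4 (N j)) → Finset (ι X))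
    (GA GB : (X : Σ j : ℕ, TDom 4 (N j)) → ι X → ℝ)
    {κ θ C₅ A : ℝ} {m : ℕ} (hκ : 0 < κ) (hθ : 0 ≤ θ) (hC₅ : 0 ≤ C₅) (hA : 0 ≤ A)
    (hK : ∀ X, KA X - KB X = ∑ i ∈ P X, (GA X i - GB X i))
    (hG : ∀ X, ∀ i ∈ P X, |GA X i - GB X i| ≤ C₅ * θ ^ X.1 * Real.exp (-(κ * torusTreeLen X.2.1)))
    (hP : ∀ X, ((P X).card : ℝ) ≤ A * (torusTreeLen X.2.1 + 1) ^ m) (W' : Set (ℕ → ℝ)) :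
    NE5 (C := torusCarriers N W) (reFunctional N W fun j X _ => ((KA ⟨j, X⟩ : ℝ) : ℂ))
      (reFunctional N W fun j X _ => ((KB ⟨j, X⟩ : ℝ) : ℂ)) W' (κ / 2) θ
      (C₅ * A * ((m.factorial : ℝ) * (2 / κ) ^ m * Real.exp (κ / 2))) := by
  have hBpos := polyTreeLoss_const_pos hκ m
  refine ne5_reFunctional_of_real N W KA KB (by positivity) hθ (fun X => ?_) W'
  have hθX : 0 ≤ θ ^ X.1 := pow_nonneg hθ _
  have ht : 0 ≤ torusTreeLen X.2.1 := torusTreeLen_nonneg _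
  have hB := polyTreeLoss_le hκ m ht
  rw [TreeLengthTorus.tsys_dj]
  calc |KA X - KB X| = |∑ i ∈ P X, (GA X i - GB X i)| := by rw [hK X]
    _ ≤ ∑ i ∈ P X, |GA X i - GB X i| := Finset.abs_sum_le_sum_abs _ _
    _ ≤ ∑ _i ∈ P X, C₅ * θ ^ X.1 * Real.exp (-(κ * torusTreeLen X.2.1)) := Finset.sum_le_sum (hG X)
    _ = (P X).card * (C₅ * θ ^ X.1 * Real.exp (-(κ * torusTreeLen X.2.1))) := by
        rw [Finset.sum_const, nsmul_eq_mul]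
    _ ≤ A * (torusTreeLen X.2.1 + 1) ^ m * (C₅ * θ ^ X.1 * Real.exp (-(κ * torusTreeLen X.2.1))) :=
        mul_le_mul_of_nonneg_right (hP X) (by positivity)
    _ = A * C₅ * θ ^ X.1 * ((torusTreeLen X.2.1 + 1) ^ m * Real.exp (-(κ * torusTreeLen X.2.1))) := by ring
    _ ≤ A * C₅ * θ ^ X.1 * (((m.factorial : ℝ) * (2 / κ) ^ m * Real.exp (κ / 2))
          * Real.exp (-(κ / 2 * torusTreeLen X.2.1))) :=
        mul_le_mul_of_nonneg_left hB (by positivity)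
    _ = C₅ * A * ((m.factorial : ℝ) * (2 / κ) ^ m * Real.exp (κ / 2)) * θ ^ X.1
          * Real.exp (-(κ / 2 * torusTreeLen X.2.1)) := by ring

end EndCarriers

/-! ## §4 The count: a domain carries polynomially many pairs of its own cubes -/

/-- **PAIRS OF CUBES OF A DOMAIN ARE POLYNOMIALLY MANY IN ITS TREE LENGTH.**  For a non-empty torus-face-connected family
`X` of cubes of `(ℤ∕N)^d`: `|X ×ˢ X| = |X|² ≤ (4·2^d)²·(d_j(X) + 1)²` — the lower half of (2.30), repaired
(`TreeLengthTorus.card_le_torusTreeLen`: `|X| ≤ 2^d(4d_j(X) + 1) ≤ 4·2^d·(d_j(X) + 1)`), squared.  This is the count binder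
`hP` of `ne5_reFunctional_of_locatedSum` with `m = 2`, `A = (4·2^d)²` for the reading «all pairs of cubes of `X`».
[cite: Balaban1988RG2Cluster, (2.30) p.18 (lower half, repaired form)] -/
theorem card_pairs_le_of_tFaceConnected {d N : ℕ} [NeZero N] {X : Finset (TPt d N)} (hX : X.Nonempty)
    (hc : TFaceConnected X) :
    ((X ×ˢ X).card : ℝ) ≤ (4 * 2 ^ d) ^ 2 * (torusTreeLen X + 1) ^ 2 := by
  have h1 := card_le_torusTreeLen hX hc
  have ht : 0 ≤ torusTreeLen X := torusTreeLen_nonneg X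
  have h2 : (X.card : ℝ) ≤ 4 * 2 ^ d * (torusTreeLen X + 1) := by
    calc (X.card : ℝ) ≤ 2 ^ d * (4 * torusTreeLen X + 1) := h1
      _ ≤ 2 ^ d * (4 * (torusTreeLen X + 1)) := by
          refine mul_le_mul_of_nonneg_left ?_ (by positivity); linarith
      _ = 4 * 2 ^ d * (torusTreeLen X + 1) := by ring
  have h0 : (0 : ℝ) ≤ X.card := Nat.cast_nonneg _
  rw [Finset.card_product, Nat.cast_mul]
  calc (X.card : ℝ) * X.card ≤ (4 * 2 ^ d * (torusTreeLen X + 1)) * (4 * 2 ^ d * (torusTreeLen X + 1)) :=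
        mul_le_mul h2 h2 h0 (by positivity)
    _ = (4 * 2 ^ d) ^ 2 * (torusTreeLen X + 1) ^ 2 := by ring

/-- The same for a localization domain `X ∈ 𝐃_j` of the torus catalogue (`TDom`), in the tree-length letter `(tsys d N).dj`
of the END's carriers. [cite: Balaban1988RG2Cluster, (2.30) p.18 (lower half, repaired form)] -/
theorem card_pairs_le_of_tdom {d N : ℕ} [NeZero N] (X : TDom d N) :
    ((X.1 ×ˢ X.1).card : ℝ) ≤ (4 * 2 ^ d) ^ 2 * ((tsys d N).dj X + 1) ^ 2 :=
  card_pairs_le_of_tFaceConnected X.2.1 X.2.2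

/-! ## §5 All pairs of cubes of a live domain -/

section CubePairs

variable {L' : ℕ} [NeZero L']

/-- **THE «ALL PAIRS OF CUBES» READING IS `NE5` AT THE END'S CARRIERS.**  If the two read-outs differ at each domain
`⟨j, X⟩` by the sum over ALL pairs `(p, q)` of cubes of `X` of line contributions located at `X` —
`|G_A X (p,q) − G_B X (p,q)| ≤ C₅·θ^j·e^{−κ·d_j(X)}` (e.g. King's (4.42) graph of a pair of blocks `p, q ∈ X` with
`ρ·d_j(X) ≤ |p − q|_{T₁}`, module 1 §2, `κ = κ_King·ρ`; pairs of `X` that are NOT so located are to be given `G_A = G_B`) —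
then `NE5 (torusCarriers N W) (reFunctional … K_A) (reFunctional … K_B) W′ (κ∕2) θ (C₅·(4·2^4)²·(2!(2∕κ)² e^{κ∕2}))`:
§3 with the count of §4 (`m = 2`, `A = (4·2^4)² = 4096`). [cite: Balaban1987RG1, (0.24)-(0.25) p.257, Thm 1 p.259; Balaban1988RG2Cluster, (2.30) p.18] -/
theorem ne5_reFunctional_of_cubePairs (N : ℕ → ℕ) [∀ j, NeZero (N j)]
    (W : (j : ℕ) → TwoTorusStep 4 L' (N j)) (KA KB : (Σ j : ℕ, TDom 4 (N j)) → ℝ)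
    (GA GB : (X : Σ j : ℕ, TDom 4 (N j)) → TPt 4 (N X.1) × TPt 4 (N X.1) → ℝ)
    {κ θ C₅ : ℝ} (hκ : 0 < κ) (hθ : 0 ≤ θ) (hC₅ : 0 ≤ C₅)
    (hK : ∀ X, KA X - KB X = ∑ pq ∈ X.2.1 ×ˢ X.2.1, (GA X pq - GB X pq))
    (hG : ∀ X, ∀ pq ∈ X.2.1 ×ˢ X.2.1, |GA X pq - GB X pq| ≤ C₅ * θ ^ X.1 * Real.exp (-(κ * torusTreeLen X.2.1)))
    (W' : Set (ℕ → ℝ)) :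
    NE5 (C := torusCarriers N W) (reFunctional N W fun j X _ => ((KA ⟨j, X⟩ : ℝ) : ℂ))
      (reFunctional N W fun j X _ => ((KB ⟨j, X⟩ : ℝ) : ℂ)) W' (κ / 2) θ
      (C₅ * (4 * 2 ^ 4) ^ 2 * (((2 : ℕ).factorial : ℝ) * (2 / κ) ^ 2 * Real.exp (κ / 2))) :=
  ne5_reFunctional_of_locatedSum N W KA KB (fun X => X.2.1 ×ˢ X.2.1) GA GB hκ hθ hC₅ (by positivity) hK hG
    (fun X => card_pairs_le_of_tdom X.2) W'

end CubePairs

end Summit.QuantumFields.YangMills.BalabanUVNodes.N18EndCarriersLineSums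

end
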